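import Summits.QuantumFields.YangMills.Theorems.BalabanUVNodesN05SubBP2DPerKappaSlotOfGuarded
import Summits.QuantumFields.YangMills.Theorems.BalabanUVNodesN05SubBP2DPerT8SrvGammaPrimeGuarded
import Summits.QuantumFields.YangMills.Theorems.BalabanUVNodesN05SubBP2DPerKappaSlotExistsGuarded
import Literature.MathematicalPhysics.QuantumFieldTheory.Balaban1983to89.Node00.CarriersB8SubBPCutP5Kappa
import Literature.MathematicalPhysics.QuantumFieldTheory.Balaban1983to89.B8Prop6PrintedZdCubPGamma

/-!
# BalabanUVNodes ∕ N05 ([Balaban1985RegularSpaces] Lemma 1 p. 79 – Thm 8 p. 101, Prop. 5 p. 94, (1.3)–(1.5) p. 77, p. 77 «Ω_j ⊂ T_η»): (10)′ — THE WITNESS SLOT OF RECORD Slot8κ′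
# `B8LeafOfRecordSubBP₂DPerκ θ P Mκ Rκ ⟨λ.cutSubBP₅κPer P Mκ Rκ c₁ ρ₀, ax⟩` INHABITED FROM THE PERIODICITY-GUARDED SOCKETS OF PRINT'S SHAPE AT PRINT-CLASS PERIODIC MEMBERS
# (director-ym №227 (b) «GUARDED REQUIRED», №227 (b′-2), №230 (B); plan YMPLAN-G87-N05-10PRIME + dag-n05-c WORD (10)′; WORK-SPLIT dag-n05-c ∕ dag-n05-d)

Track A of `YM-PLAN.md` (cell `pub-ymgap`, HUMAN RULING D-0062), node **N05**; seat `pub-ymgap-dag-n05-d` (g14), 2026-08-28; bears on K1⁹ `stmt-QuantumFields-27364`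
(`--supports … --as helper`, count-neutral).

WHAT (the closer-facing supplier statement of the GUARDED road — every displayed hypothesis a PRINT socket text, asked at PERIODIC data, at the PRINT-CLASS PERIODIC members
`a : Node00.IdxB8SubDPerκ θ P Mκ Rκ`; constants OUTER — no `exists_B₈` inside, the closer ∕ suppliers pick Theorem 8's constants under (8′)∕(9′)'s inequalities):
* DISPLAYED: the ONE sourced guarded socket family of Theorem 4's frame at (1.146) (`SP5base ∕ SP5 ∕ SH59src ∕ SP5u`, dag-n05-c's (9′) texts VERBATIM, re-indexed; servers:
  lit-balaban IR-N05-P5NS instance (ii) for Prop 5, N06 for [4] Thm 3.3 with periodic source) · the guarded sourced b9 socket of Proposition 3's frame `SB9srcH2Per` ((9′) ∕ T6e's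
  text; server n06-b) · Proposition 3 AS PRINTED at the κ-periodic family `hP3` (server: dag-n05-w1's guarded-socket road) · Proposition 5's existence ∕ uniqueness at the
  PERIODIC members of record `p5ePer ∕ p5uPer` (`lanOfRecordSubCκPer … (5dLB₈(1+11d²))`, IR currency 2) · Proposition 6 in dag-n05-e's SERVED shape (`hP6` with `ρ₀ B₁⋆ c₁⋆`;
  discharged by name at the door by `prop6Printed_zdCubP_γ_holds_record_dvd`, then `B₈` is picked with `B₁⋆ ≤ 5dLB₈(1+11d²)`).
* INSIDE: the layer literal (`B₁ := 5dLB₈(1+11d²)`, `B₂ := 5dLB₈β(1+11d²)`, `B₁′ := 5dLB₈`, `C₂ := 2097152(d+1)²L²`, `inp := ⟨B₀, B₀′⟩`), Lemma 1 (kernel), Theorems 2 ∕ 4 by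
  dag-n05-c's T6b ∕ T6a at the abstract source pinned to Theorem 8's admissibility and the ZERO source, Theorem 8 surviving by T6c with T6e's sourced Proposition 3, all at
  `J := IdxB8SubDPerκ θ P Mκ Rκ`, `ι := toZdIdx`, `p := fun _ => P` (member laws from the index's faces), the display's Proposition-7 slot at the unit-axial junk map (census),
  the pin's `Iff.rfl` reading `b8LeafOfRecordSubBP₂DPerκ_cutSubBP₅κPer_iff`.
WHAT IS PROVED (two theorems here + one in part B; no estimate; no new definition):
* ★★★ `exists_residB8_slot8κ'_of_guardedSockets_at` — at a given period `P`: `∃ lam c₁ ρ₀ ax, 0 < c₁ ∧ 1 ≤ ρ₀ ∧ B8LeafOfRecordSubBP₂DPerκ θ P Mκ Rκ ⟨lam.cutSubBP₅κPer P Mκ Rκ c₁ ρ₀, ax⟩`.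
* (part B, `…OfGuardedSocketsSlot8KappaPrime`: the same at `P := Mκ·θ.L`, `1 ≤ Mκ` = the Slot8κ′ λ-term's ∃-body LITERALLY, dag-n24-c (R3′)).
* `nonempty_idxB8SubDPerκ_slot8κ'` — the κ-index INHABITATION certificate at `P := Mκ·θ.L` under `1 ≤ Mκ`, `θ.L ≤ Rκ·Mκ` (ref-A READ-42 WATCH-K2-PIN-INHABITATION rider: the
  ∃-body is not met by an empty family when the door brings these two guards; dag-n05-w1's `nonempty_idxB8SubDPerκ`).
DOOR RECIPE (plan YMPLAN-G87-N05-10PRIME-2; for the K1⁹ door lineage): `hP6 ∕ hB₁big` are served BY NAME by dag-n05-e's PROVED `B8Prop6PrintedZdCubPGamma.prop6Printed_zdCubP_γ_holds_record_dvd`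
— `obtain ⟨ρ₀, B₁⋆, c₁⋆, hρ₀, -, -, hc₁⋆, hP6⟩ := prop6Printed_zdCubP_γ_holds_record_dvd θ hD hL5 (t := 1) le_rfl`, then pick `B₈` with `B₁⋆ ≤ 5dLB₈(1+11d²)` and the (8′)∕(9′)
inequalities (`hB₀8 hγB hγB″ hB8β`), then apply the theorem; every OTHER displayed binder is a print socket ∕ letter text at PRINT-CLASS periodic members or `p5ePer ∕ p5uPer ∕ hP3`
(suppliers IR-N05-P5NS (ii) ∕ N06 ∕ dag-n05-w1's road) — none a derived-shape letter.
HONEST FRAMING: composition BY NAME; 0 estimates of Bałaban's proved here; EVERY socket ∕ `hP3` ∕ `p5ePer` ∕ `p5uPer` ∕ `hP6`'s family remains a HYPOTHESIS, of print's shape (torus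
`T_η` read as `P`-periodic data on `ℤᵈ`, print's (1.3)–(1.4) class at the pinned `Mκ`, periodic letters) — servable by name by the package's suppliers, NOT served here; Proposition 7's
slot junk-inhabited (census); count-neutral; **N05 NOT discharged** (director-ym №227 (b): only when every consumed socket is served by name); FLAG №4 OPEN; K1⁹ NOT claimed;
Bałaban AS PRINTED (Thm 8 SURVIVING form, GAPS G-B8-13); one finite 𝕋⁴ programme at fixed ε; nothing continuum ∕ ℝ⁴ ∕ OS ∕ mass-gap ∕ Clay.  No `sorry`, no new definition.
Unit `pub-ymgap-dag-n05-d` (g14).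
[cite: Balaban1985RegularSpaces, Lemma 1 p.79, Thm 2 p.83, Prop. 3 p.87, Thm 4 p.88, Prop. 5 (1.107)–(1.109) p.94, Prop. 6 (1.134)–(1.138) p.99, Prop. 7 p.100, Thm 8 (1.146) p.101, (1.3)–(1.5) p.77, p.77 («Ω_j ⊂ T_η»); Balaban1985BackgroundPropagators, Thm 3.1 p.397, Thm 3.3 p.399, (3.40) p.397]
-/

noncomputable section

namespace Summit.QuantumFields.YangMills.BalabanUVNodes.N05SubBP2DK2PerKappaSlotExistsOfGuardedSockets

open Literature.MathematicalPhysics.QuantumFieldTheory.Balaban1983to89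
open Literature.MathematicalPhysics.QuantumFieldTheory.Balaban1983to89.Node00
open Literature.MathematicalPhysics.QuantumFieldTheory.Balaban1983to89.B8IdxB8LawsB (IdxB8LawsB IdxB8SubB)
open Literature.MathematicalPhysics.QuantumFieldTheory.Balaban1983to89.B8LeafModelZd (ZdIdx)
open Literature.MathematicalPhysics.QuantumFieldTheory.Balaban1983to89.B8LeafModelZd3P2 (zdGF3HP₂)
open Literature.MathematicalPhysics.QuantumFieldTheory.Balaban1983to89.B8LeafModelZdHP2Per (zdGF3HP₂Per)
open Literature.MathematicalPhysics.QuantumFieldTheory.Balaban1983to89.B8TowerBondsPrinted (towerBondsP)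
open Literature.MathematicalPhysics.QuantumFieldTheory.Balaban1983to89.B8Lemma1NonAbelian (mulCfg blockPairNA lemma1Printed_blockPairNA)
open Literature.MathematicalPhysics.QuantumFieldTheory.Balaban1983to89.B8Thm8SurvivingZdGF3HP2PerMapLanEGammaGuarded (thm8SurvivingAt_zdGF3HP₂Per_map_lanE_γ'_guarded)
open Literature.MathematicalPhysics.QuantumFieldTheory.Balaban1983to89.B8Prop3SrcZdHP2PerGamma (sp3src_zdGF3HP₂Per_map_of_sockB9P3srcH2Per_γ)
open Literature.MathematicalPhysics.QuantumFieldTheory.Balaban1983to89.B8Thm4ZdGF3HP2PerMapGammaPrime (thm4Printed_zdGF3HP₂Per_mapJ_γ')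
open Literature.MathematicalPhysics.QuantumFieldTheory.Balaban1983to89.B8Thm2ZdGF3HP2PerMapGammaPrime (thm2Printed_zdGF3HP₂Per_mapJ_γ')
open Literature.MathematicalPhysics.QuantumFieldTheory.Balaban1983to89.B8LanF146 (LanF146 lanF146_top_iff lanF146_zero_iff)
open Literature.MathematicalPhysics.QuantumFieldTheory.Balaban1983to89.B8Eq138LandauZd (inR138_zero)
open Literature.MathematicalPhysics.QuantumFieldTheory.Balaban1983to89.B8Prop5LandauDataZdPer (zdLanPer)
open Summit.QuantumFields.YangMills.BalabanUVNodes.N05SubBP2DPerKappaSlotExistsGuarded (prop7PrintedR_famB8OfRecordSubBP₂DPer_unitAxial)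
open T4TermwiseTorus (IsPeriodic)
open MatrixLog B7Prop1Explicit B7Prop2Explicit B7Prop1Local B7Eq92Concrete
open B8Ineq130 (tlo thi)
open B8Ineq132 (InAk covDerivFwd)
open B8Eq119TwistedAxial (Restr129 InAx)
open B8Eq140Level (SideTouches)
open B8Eq138LandauZd (covLap InR138 IsLandau146W)
open B8Eq184Proof (gaugeExp cfgExp)
open B8Eq146AExpansion (iEta plaqCovDeriv)
open B8Eq143PlaqExpansion (pdiv)
open B7Prop4GeneralLevels (linCovIter)
open B8Eq155JBound (Jcur wsup)
open B8ScaledSupNorm (bondNorm msup Bdd msup_le bdd_of_forall)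
open B9Eq340HolderZd (hquot AdmPair)

-- `Site` alone could resolve to the torus sites of `Setup.lean`; re-export the `ℤ^d` sites of `B7Prop1Explicit`.
export B7Prop1Explicit (Site)

section GuardedSockets

variable (θ : Stage3Params)

/-- ★★★ **THE WITNESS SLOT OF RECORD FROM THE GUARDED SOCKETS, AT A GIVEN PERIOD `P`** — constants outer, the layer literal and Lemma 1 ∕ Thm 2 ∕ Thm 4 ∕ Thm 8 ∕ Prop 7 inside
(dag-n05-c's T6a ∕ T6b ∕ T6c ∕ T6e at `J := IdxB8SubDPerκ θ P Mκ Rκ`, unit-axial Prop 7), displayed: the sourced guarded socket family, the sourced b9 socket of Prop. 3's frame,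
Proposition 3 at the κ-periodic family, Proposition 5 at the periodic members of record, Proposition 6 in the served shape.
[cite: Balaban1985RegularSpaces, Lemma 1 – Thm 8 pp.79–101, Prop. 5 p.94, (1.3)–(1.5) p.77, p.77 («Ω_j ⊂ T_η»); Balaban1985BackgroundPropagators, Thm 3.3 p.399] -/
theorem exists_residB8_slot8κ'_of_guardedSockets_at (hD : 2 ≤ θ.D) (Mκ Rκ P : ℕ)
    -- the primitive constants of the layer ([4] (3.40) `B₀`, the free constant `B₀′`, the Hölder pair) — OUTER
    {B₀ B₀' B₀β β : ℝ} {len : Site θ.D → ℝ} (hB₀ : 0 < B₀) (hB₀' : 0 < B₀') (hB₀β : 0 < B₀β)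
    -- PROPOSITION 6 IN dag-n05-e's SERVED SHAPE (`prop6Printed_zdCubP_γ_holds_record_dvd`): print cubes at `ρ₀`, constants `B₁⋆, c₁⋆` — OUTER, displayed
    {ρ₀ : ℕ} {B₁s c₁s : ℝ} (hρ₀ : 1 ≤ ρ₀) (hc₁s : 0 < c₁s)
    (hP6 : ∀ {ι : Type} (f : ι → ZdIdx θ.D θ.L) (B₁'' c₁'' : ℝ), B₁s ≤ B₁'' → c₁'' ≤ c₁s →
      B8.Prop6Printed θ.D (θ.L : ℝ) B₁'' c₁'' (fun j => zdCubP θ.𝔸 θ.L ρ₀ (f j)))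
    -- Theorem 8's constants — OUTER, with (8′)∕(9′)'s inequalities and `B₁⋆ ≤ 5dLB₈(1+11d²)`
    {cP cu cP3 γ₈ γ' γ'' γβ B₈ B₈β : ℝ} (hcP : 0 < cP) (hcu : 0 < cu) (hcP3 : 0 < cP3) (hγ₈ : 1 ≤ γ₈) (hγ' : 0 ≤ γ') (hγ'' : 0 ≤ γ'')
    (hB : 2 ≤ 5 * (θ.D : ℝ) * θ.L * B₀) (hB₀8 : B₀ ≤ B₈)
    (hγB : 5 * (θ.D : ℝ) * θ.L * B₀ + 2 * (γ' * B₀) ≤ 5 * (θ.D : ℝ) * θ.L * B₈)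
    (hγB'' : 5 * (θ.D : ℝ) * θ.L * B₀ + 2 * (γ'' * B₀) ≤ 5 * (θ.D : ℝ) * θ.L * B₈)
    (hB8β : 5 * (θ.D : ℝ) * θ.L * B₀β + 2 * B₀β * (γ'' * B₀) + γβ ≤ 5 * (θ.D : ℝ) * θ.L * B₈β)
    (hB₁big : B₁s ≤ 5 * (θ.D : ℝ) * θ.L * B₈ * (1 + 11 * (θ.D : ℝ) ^ 2))
    -- THE ONE SOURCED GUARDED SOCKET FAMILY OF THEOREM 4's FRAME AT (1.146) + THE GUARDED SOURCED b9 SOCKET OF PROP. 3's FRAME (dag-n05-c's (9′) texts VERBATIM),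
    -- at the PRINT-CLASS PERIODIC MEMBERS `a : IdxB8SubDPerκ θ P Mκ Rκ` (member `a.toZdIdx`, period `P`) — HYPOTHESES (print's shape; servers: IR-N05-P5NS (ii), N06)
    (SP5base : ∀ a : IdxB8SubDPerκ θ P Mκ Rκ, ∀ α₀ α₁ : ℝ, 0 < α₀ → 0 < α₁ → α₀ + α₁ ≤ cP →
      ∀ U₀ U' : Site θ.D → Fin θ.D → θ.𝔸ˣ, (∀ x κ, U₀ x κ ∈ unitaryUnits θ.𝔸) → (∀ x κ, U' x κ ∈ unitaryUnits θ.𝔸) →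
      IsPeriodic P U₀ → IsPeriodic P U' → ∀ φ : Site θ.D → θ.𝔸, (((InR138 θ.L a.toZdIdx.k a.toZdIdx.η (a.toZdIdx.Ω 0) (a.toZdIdx.Λs a.toZdIdx.k) U₀ φ ∧ (∀ x, IsSelfAdjoint (φ x)) ∧ (∀ x, x ∉ a.toZdIdx.Ω 0 → φ x = 0) ∧
          Bdd θ.L a.toZdIdx.k a.toZdIdx.η (-(2 : ℝ)) (fun j (x : Site θ.D) => x ∈ a.toZdIdx.Ω j) φ) ∧ IsPeriodic P φ) ∧
        msup θ.L a.toZdIdx.k a.toZdIdx.η (-(2 : ℝ)) (fun j (x : Site θ.D) => x ∈ a.toZdIdx.Ω j) φ < γ₈ * (α₀ + α₁)) →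
      InAk θ.L a.toZdIdx.k a.toZdIdx.η α₀ a.toZdIdx.Ω U₀ → InAk θ.L a.toZdIdx.k a.toZdIdx.η α₀ a.toZdIdx.Ω (mulCfg U' U₀) → (∀ m, m ≤ a.toZdIdx.k → InAx θ.L m (a.toZdIdx.Λs m) U₀ (mulCfg U' U₀)) →
      (∀ j, j ≤ a.toZdIdx.k → ∀ (z : Site θ.D) (μ : Fin θ.D),
        ((∀ x, InBox (tlo θ.L z j) (thi θ.L z j) x → x ∈ a.toZdIdx.Ω j) ∨ (∀ x, InBox (tlo θ.L (z + e μ) j) (thi θ.L (z + e μ) j) x → x ∈ a.toZdIdx.Ω j)) →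
        ‖(avgIter θ.L (mulCfg U' U₀) j z μ : θ.𝔸) - (avgIter θ.L U₀ j z μ : θ.𝔸)‖ ≤ α₁) →
      (∀ b ∈ {b : Site θ.D × Fin θ.D | SideTouches (a.toZdIdx.Ω 0) b.1 b.2}, ‖((U' b.1 b.2 : θ.𝔸ˣ) : θ.𝔸) - 1‖ ≤ α₁) →
      (∃ (v : Site θ.D → θ.𝔸ˣ) (la : Site θ.D → θ.𝔸), (∀ x, v x ∈ unitaryUnits θ.𝔸) ∧ (∀ x, x ∉ a.toZdIdx.Ω 0 → v x = 1) ∧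
        (∀ j, j ≤ 1 → ∀ b ∈ {b : Site θ.D × Fin θ.D | SideTouches (a.toZdIdx.Ω j) b.1 b.2}, (v b.1 : θ.𝔸) = ((gaugeExp la b.1 : θ.𝔸ˣ) : θ.𝔸) ∧
        (v (b.1 + e b.2) : θ.𝔸) = ((gaugeExp la (b.1 + e b.2) : θ.𝔸ˣ) : θ.𝔸)) ∧
        (∀ j, j ≤ 1 → ∀ b ∈ {b : Site θ.D × Fin θ.D | SideTouches (a.toZdIdx.Ω j) b.1 b.2},
        ‖la b.1‖ ≤ (8 * B₀' * (5 * (θ.D : ℝ) * θ.L * B₈) * (α₀ + α₁)) ∧ ((θ.L : ℝ) ^ j * a.toZdIdx.η) * ‖covDerivFwd a.toZdIdx.η U₀ b.2 la b.1‖ ≤ (8 * B₀' * (5 * (θ.D : ℝ) * θ.L * B₈) * (α₀ + α₁))) ∧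
        LanF146 θ.L a.toZdIdx.k a.toZdIdx.η (a.toZdIdx.Ω 0) a.toZdIdx.Λs U₀ φ 1 (mgauge U₀ v⁻¹ U') ∧ Restr129 θ.L 1 (a.toZdIdx.Λs 1) U₀ ((1 : Site θ.D → θ.𝔸ˣ) * v) ∧ IsPeriodic P v))
    (SP5 : ∀ a : IdxB8SubDPerκ θ P Mκ Rκ, ∀ α₀ α₁ : ℝ, 0 < α₀ → 0 < α₁ → α₀ + α₁ ≤ cP →
      ∀ U₀ U' : Site θ.D → Fin θ.D → θ.𝔸ˣ, (∀ x κ, U₀ x κ ∈ unitaryUnits θ.𝔸) → (∀ x κ, U' x κ ∈ unitaryUnits θ.𝔸) →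
      IsPeriodic P U₀ → IsPeriodic P U' → ∀ φ : Site θ.D → θ.𝔸, (((InR138 θ.L a.toZdIdx.k a.toZdIdx.η (a.toZdIdx.Ω 0) (a.toZdIdx.Λs a.toZdIdx.k) U₀ φ ∧ (∀ x, IsSelfAdjoint (φ x)) ∧ (∀ x, x ∉ a.toZdIdx.Ω 0 → φ x = 0) ∧
          Bdd θ.L a.toZdIdx.k a.toZdIdx.η (-(2 : ℝ)) (fun j (x : Site θ.D) => x ∈ a.toZdIdx.Ω j) φ) ∧ IsPeriodic P φ) ∧
        msup θ.L a.toZdIdx.k a.toZdIdx.η (-(2 : ℝ)) (fun j (x : Site θ.D) => x ∈ a.toZdIdx.Ω j) φ < γ₈ * (α₀ + α₁)) →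
      InAk θ.L a.toZdIdx.k a.toZdIdx.η α₀ a.toZdIdx.Ω U₀ → InAk θ.L a.toZdIdx.k a.toZdIdx.η α₀ a.toZdIdx.Ω (mulCfg U' U₀) → (∀ m, m ≤ a.toZdIdx.k → InAx θ.L m (a.toZdIdx.Λs m) U₀ (mulCfg U' U₀)) →
      (∀ j, j ≤ a.toZdIdx.k → ∀ (z : Site θ.D) (μ : Fin θ.D),
        ((∀ x, InBox (tlo θ.L z j) (thi θ.L z j) x → x ∈ a.toZdIdx.Ω j) ∨ (∀ x, InBox (tlo θ.L (z + e μ) j) (thi θ.L (z + e μ) j) x → x ∈ a.toZdIdx.Ω j)) →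
        ‖(avgIter θ.L (mulCfg U' U₀) j z μ : θ.𝔸) - (avgIter θ.L U₀ j z μ : θ.𝔸)‖ ≤ α₁) →
      (∀ b ∈ {b : Site θ.D × Fin θ.D | SideTouches (a.toZdIdx.Ω 0) b.1 b.2}, ‖((U' b.1 b.2 : θ.𝔸ˣ) : θ.𝔸) - 1‖ ≤ α₁) →
      (∀ m, 1 ≤ m → m < a.toZdIdx.k → ∀ (u₁ : Site θ.D → θ.𝔸ˣ) (U₁ : Site θ.D → Fin θ.D → θ.𝔸ˣ) (A : Site θ.D → Fin θ.D → θ.𝔸),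
        (∀ x, u₁ x ∈ unitaryUnits θ.𝔸) → (∀ x, x ∉ a.toZdIdx.Ω 0 → u₁ x = 1) → IsPeriodic P u₁ → IsPeriodic P U₁ → IsPeriodic P A →
        mgauge U₀ u₁ U₁ = U' → Restr129 θ.L m (a.toZdIdx.Λs m) U₀ u₁ →
        LanF146 θ.L a.toZdIdx.k a.toZdIdx.η (a.toZdIdx.Ω 0) a.toZdIdx.Λs U₀ φ m U₁ →
        (∀ j, j ≤ m → ∀ b ∈ {b : Site θ.D × Fin θ.D | SideTouches (a.toZdIdx.Ω j) b.1 b.2},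
        U₁ b.1 b.2 = cfgExp a.toZdIdx.η A b.1 b.2 ∧ IsSelfAdjoint (A b.1 b.2) ∧ ‖A b.1 b.2‖ ≤ (5 * (θ.D : ℝ) * θ.L * B₈ * (α₀ + α₁)) * ((θ.L : ℝ) ^ j * a.toZdIdx.η)⁻¹) →
        ∃ (v : Site θ.D → θ.𝔸ˣ) (la : Site θ.D → θ.𝔸), (∀ x, v x ∈ unitaryUnits θ.𝔸) ∧ (∀ x, x ∉ a.toZdIdx.Ω 0 → v x = 1) ∧
        (∀ j, j ≤ m + 1 → ∀ b ∈ {b : Site θ.D × Fin θ.D | SideTouches (a.toZdIdx.Ω j) b.1 b.2}, (v b.1 : θ.𝔸) = ((gaugeExp la b.1 : θ.𝔸ˣ) : θ.𝔸) ∧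
        (v (b.1 + e b.2) : θ.𝔸) = ((gaugeExp la (b.1 + e b.2) : θ.𝔸ˣ) : θ.𝔸)) ∧
        (∀ j, j ≤ m + 1 → ∀ b ∈ {b : Site θ.D × Fin θ.D | SideTouches (a.toZdIdx.Ω j) b.1 b.2},
        ‖la b.1‖ ≤ (8 * B₀' * (5 * (θ.D : ℝ) * θ.L * B₈) * (α₀ + α₁)) ∧ ((θ.L : ℝ) ^ j * a.toZdIdx.η) * ‖covDerivFwd a.toZdIdx.η U₀ b.2 la b.1‖ ≤ (8 * B₀' * (5 * (θ.D : ℝ) * θ.L * B₈) * (α₀ + α₁))) ∧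
        LanF146 θ.L a.toZdIdx.k a.toZdIdx.η (a.toZdIdx.Ω 0) a.toZdIdx.Λs U₀ φ (m + 1) (mgauge U₀ v⁻¹ U₁) ∧ Restr129 θ.L (m + 1) (a.toZdIdx.Λs (m + 1)) U₀ (u₁ * v) ∧ IsPeriodic P v))
    (SH59src : ∀ a : IdxB8SubDPerκ θ P Mκ Rκ, ∀ α₀ α₁ : ℝ, 0 < α₀ → 0 < α₁ → α₀ + α₁ ≤ cP →
      ∀ U₀ U' : Site θ.D → Fin θ.D → θ.𝔸ˣ, (∀ x κ, U₀ x κ ∈ unitaryUnits θ.𝔸) → (∀ x κ, U' x κ ∈ unitaryUnits θ.𝔸) →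
      IsPeriodic P U₀ → IsPeriodic P U' → ∀ φ : Site θ.D → θ.𝔸, (((InR138 θ.L a.toZdIdx.k a.toZdIdx.η (a.toZdIdx.Ω 0) (a.toZdIdx.Λs a.toZdIdx.k) U₀ φ ∧ (∀ x, IsSelfAdjoint (φ x)) ∧ (∀ x, x ∉ a.toZdIdx.Ω 0 → φ x = 0) ∧
          Bdd θ.L a.toZdIdx.k a.toZdIdx.η (-(2 : ℝ)) (fun j (x : Site θ.D) => x ∈ a.toZdIdx.Ω j) φ) ∧ IsPeriodic P φ) ∧
        msup θ.L a.toZdIdx.k a.toZdIdx.η (-(2 : ℝ)) (fun j (x : Site θ.D) => x ∈ a.toZdIdx.Ω j) φ < γ₈ * (α₀ + α₁)) →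
      InAk θ.L a.toZdIdx.k a.toZdIdx.η α₀ a.toZdIdx.Ω U₀ → InAk θ.L a.toZdIdx.k a.toZdIdx.η α₀ a.toZdIdx.Ω (mulCfg U' U₀) → (∀ m, m ≤ a.toZdIdx.k → InAx θ.L m (a.toZdIdx.Λs m) U₀ (mulCfg U' U₀)) →
      (∀ j, j ≤ a.toZdIdx.k → ∀ (z : Site θ.D) (μ : Fin θ.D),
        ((∀ x, InBox (tlo θ.L z j) (thi θ.L z j) x → x ∈ a.toZdIdx.Ω j) ∨ (∀ x, InBox (tlo θ.L (z + e μ) j) (thi θ.L (z + e μ) j) x → x ∈ a.toZdIdx.Ω j)) →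
        ‖(avgIter θ.L (mulCfg U' U₀) j z μ : θ.𝔸) - (avgIter θ.L U₀ j z μ : θ.𝔸)‖ ≤ α₁) →
      (∀ b ∈ {b : Site θ.D × Fin θ.D | SideTouches (a.toZdIdx.Ω 0) b.1 b.2}, ‖((U' b.1 b.2 : θ.𝔸ˣ) : θ.𝔸) - 1‖ ≤ α₁) →
      (∀ m, 1 ≤ m → m ≤ a.toZdIdx.k → ∀ (u : Site θ.D → θ.𝔸ˣ) (W : Site θ.D → Fin θ.D → θ.𝔸ˣ) (A' : Site θ.D → Fin θ.D → θ.𝔸),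
        (∀ x, u x ∈ unitaryUnits θ.𝔸) → IsPeriodic P u → IsPeriodic P W → IsPeriodic P A' →
        mgauge U₀ u W = U' → Restr129 θ.L m (a.toZdIdx.Λs m) U₀ u → LanF146 θ.L a.toZdIdx.k a.toZdIdx.η (a.toZdIdx.Ω 0) a.toZdIdx.Λs U₀ φ m W →
        (∀ y τ, IsSelfAdjoint (A' y τ)) →
        (∀ j, j ≤ m → ∀ y τ, SideTouches (a.toZdIdx.Ω j) y τ →
        W y τ = cfgExp a.toZdIdx.η A' y τ ∧ ‖A' y τ‖ ≤ (2 * (θ.L * (5 * (θ.D : ℝ) * θ.L * B₈ * (α₀ + α₁))) + 8 * (8 * B₀' * (5 * (θ.D : ℝ) * θ.L * B₈) * (α₀ + α₁))) * ((θ.L : ℝ) ^ j * a.toZdIdx.η)⁻¹) →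
        (∀ y τ, (∀ j, j ≤ m → ¬ SideTouches (a.toZdIdx.Ω j) y τ) → A' y τ = 0) →
        msup θ.L m a.toZdIdx.η (-(1 : ℝ)) (fun j (b : Site θ.D × Fin θ.D) => SideTouches (a.toZdIdx.Ω j) b.1 b.2) (fun b => A' b.1 b.2)
        ≤ B₀ * (bondNorm θ.L m a.toZdIdx.η (-(3 : ℝ)) a.toZdIdx.Ω (fun x μ => Jcur a.toZdIdx.η U₀ A' μ x)
        + wsup 1 (fun p : {p : ℕ × (Site θ.D × Fin θ.D) // p.1 ≤ m ∧ p.2 ∈ towerBondsP θ.L a.toZdIdx.Ω (a.toZdIdx.Λs m) p.1} =>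
        linCovIter θ.L U₀ (iEta a.toZdIdx.η A') p.1.1 p.1.2.1 p.1.2.2)) + γ' * B₀ * (α₀ + α₁) ∧
        msup θ.L m a.toZdIdx.η (-(2 : ℝ)) (fun j (t : Fin θ.D × Fin θ.D × Site θ.D) => SideTouches (a.toZdIdx.Ω j) t.2.2 t.2.1)
        (fun t => covDerivFwd a.toZdIdx.η U₀ t.1 (fun z => A' z t.2.1) t.2.2)
        ≤ B₀ * (bondNorm θ.L m a.toZdIdx.η (-(3 : ℝ)) a.toZdIdx.Ω (fun x μ => Jcur a.toZdIdx.η U₀ A' μ x)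
        + wsup 1 (fun p : {p : ℕ × (Site θ.D × Fin θ.D) // p.1 ≤ m ∧ p.2 ∈ towerBondsP θ.L a.toZdIdx.Ω (a.toZdIdx.Λs m) p.1} =>
        linCovIter θ.L U₀ (iEta a.toZdIdx.η A') p.1.1 p.1.2.1 p.1.2.2)) + γ' * B₀ * (α₀ + α₁)))
    (SP5u : ∀ a : IdxB8SubDPerκ θ P Mκ Rκ, ∀ α₀ α₁ : ℝ, 0 < α₀ → 0 < α₁ → α₀ + α₁ ≤ cP →
      ∀ U₀ U' : Site θ.D → Fin θ.D → θ.𝔸ˣ, (∀ x κ, U₀ x κ ∈ unitaryUnits θ.𝔸) → (∀ x κ, U' x κ ∈ unitaryUnits θ.𝔸) →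
      IsPeriodic P U₀ → IsPeriodic P U' → ∀ φ : Site θ.D → θ.𝔸, (((InR138 θ.L a.toZdIdx.k a.toZdIdx.η (a.toZdIdx.Ω 0) (a.toZdIdx.Λs a.toZdIdx.k) U₀ φ ∧ (∀ x, IsSelfAdjoint (φ x)) ∧ (∀ x, x ∉ a.toZdIdx.Ω 0 → φ x = 0) ∧
          Bdd θ.L a.toZdIdx.k a.toZdIdx.η (-(2 : ℝ)) (fun j (x : Site θ.D) => x ∈ a.toZdIdx.Ω j) φ) ∧ IsPeriodic P φ) ∧
        msup θ.L a.toZdIdx.k a.toZdIdx.η (-(2 : ℝ)) (fun j (x : Site θ.D) => x ∈ a.toZdIdx.Ω j) φ < γ₈ * (α₀ + α₁)) →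
      InAk θ.L a.toZdIdx.k a.toZdIdx.η α₀ a.toZdIdx.Ω U₀ → InAk θ.L a.toZdIdx.k a.toZdIdx.η α₀ a.toZdIdx.Ω (mulCfg U' U₀) → (∀ m, m ≤ a.toZdIdx.k → InAx θ.L m (a.toZdIdx.Λs m) U₀ (mulCfg U' U₀)) →
      (∀ j, j ≤ a.toZdIdx.k → ∀ (z : Site θ.D) (μ : Fin θ.D),
        ((∀ x, InBox (tlo θ.L z j) (thi θ.L z j) x → x ∈ a.toZdIdx.Ω j) ∨ (∀ x, InBox (tlo θ.L (z + e μ) j) (thi θ.L (z + e μ) j) x → x ∈ a.toZdIdx.Ω j)) →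
        ‖(avgIter θ.L (mulCfg U' U₀) j z μ : θ.𝔸) - (avgIter θ.L U₀ j z μ : θ.𝔸)‖ ≤ α₁) →
      (∀ b ∈ {b : Site θ.D × Fin θ.D | SideTouches (a.toZdIdx.Ω 0) b.1 b.2}, ‖((U' b.1 b.2 : θ.𝔸ˣ) : θ.𝔸) - 1‖ ≤ α₁) →
      ∀ u₁ : Site θ.D → θ.𝔸ˣ, (∀ x, u₁ x ∈ unitaryUnits θ.𝔸) → (∀ x, x ∉ a.toZdIdx.Ω 0 → u₁ x = 1) → IsPeriodic P u₁ → Restr129 θ.L a.toZdIdx.k (a.toZdIdx.Λs a.toZdIdx.k) U₀ u₁ →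
      LanF146 θ.L a.toZdIdx.k a.toZdIdx.η (a.toZdIdx.Ω 0) a.toZdIdx.Λs U₀ φ a.toZdIdx.k (mgauge U₀ u₁⁻¹ U') →
      (∃ A₁ : Site θ.D → Fin θ.D → θ.𝔸, ∀ j, j ≤ a.toZdIdx.k → ∀ (x : Site θ.D) (κ : Fin θ.D), SideTouches (a.toZdIdx.Ω j) x κ →
        mgauge U₀ u₁⁻¹ U' x κ = cfgExp a.toZdIdx.η A₁ x κ ∧ ‖A₁ x κ‖ ≤ (5 * (θ.D : ℝ) * θ.L * B₈ * (α₀ + α₁)) * ((θ.L : ℝ) ^ j * a.toZdIdx.η)⁻¹) →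
      ∀ (v w : Site θ.D → θ.𝔸ˣ) (la mu : Site θ.D → θ.𝔸),
      IsPeriodic P v → IsPeriodic P w → IsPeriodic P la → IsPeriodic P mu →
      (∀ x, ((gaugeExp la x : θ.𝔸ˣ) : θ.𝔸) = ((v x : θ.𝔸ˣ) : θ.𝔸) ∧ IsSelfAdjoint (la x) ∧ ‖la x‖ < cu) → (∀ x, x ∉ a.toZdIdx.Ω 0 → la x = 0) →
      (∀ j, j ≤ a.toZdIdx.k → ∀ b ∈ {b : Site θ.D × Fin θ.D | SideTouches (a.toZdIdx.Ω j) b.1 b.2}, ((θ.L : ℝ) ^ j * a.toZdIdx.η) * ‖covDerivFwd a.toZdIdx.η U₀ b.2 la b.1‖ < cu) →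
      (∀ x, ((gaugeExp mu x : θ.𝔸ˣ) : θ.𝔸) = ((w x : θ.𝔸ˣ) : θ.𝔸) ∧ IsSelfAdjoint (mu x) ∧ ‖mu x‖ < cu) → (∀ x, x ∉ a.toZdIdx.Ω 0 → mu x = 0) →
      (∀ j, j ≤ a.toZdIdx.k → ∀ b ∈ {b : Site θ.D × Fin θ.D | SideTouches (a.toZdIdx.Ω j) b.1 b.2}, ((θ.L : ℝ) ^ j * a.toZdIdx.η) * ‖covDerivFwd a.toZdIdx.η U₀ b.2 mu b.1‖ < cu) →
      LanF146 θ.L a.toZdIdx.k a.toZdIdx.η (a.toZdIdx.Ω 0) a.toZdIdx.Λs U₀ φ a.toZdIdx.k (mgauge U₀ v⁻¹ (mgauge U₀ u₁⁻¹ U')) → Restr129 θ.L a.toZdIdx.k (a.toZdIdx.Λs a.toZdIdx.k) U₀ (u₁ * v) →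
      LanF146 θ.L a.toZdIdx.k a.toZdIdx.η (a.toZdIdx.Ω 0) a.toZdIdx.Λs U₀ φ a.toZdIdx.k (mgauge U₀ w⁻¹ (mgauge U₀ u₁⁻¹ U')) → Restr129 θ.L a.toZdIdx.k (a.toZdIdx.Λs a.toZdIdx.k) U₀ (u₁ * w) →
      ∀ x, v x = w x)
    -- THE GUARDED SOURCED b9 SOCKET OF PROPOSITION 3's FRAME at the PERIODIC (1.5)-index, threshold `cP3` — HYPOTHESIS
    -- ([Balaban1985BackgroundPropagators] Thm 3.3 with source, asked at periodic `U₀, W, f, A′` only; = T6e's input letter for letter)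
    (SB9srcH2Per : ∀ a : IdxB8SubDPerκ θ P Mκ Rκ, ∀ α₀ α₁ α₂ : ℝ, 0 < α₀ → α₀ ≤ cP3 → 0 < α₁ → 0 < α₂ → α₂ ≤ cP3 →
      ∀ (U₀ W : Site θ.D → Fin θ.D → θ.𝔸ˣ), (∀ x κ, U₀ x κ ∈ unitaryUnits θ.𝔸) → (∀ x κ, W x κ ∈ unitaryUnits θ.𝔸) →
      IsPeriodic P U₀ → IsPeriodic P W →
      ∀ f : Site θ.D → θ.𝔸, IsPeriodic P f → InR138 θ.L a.toZdIdx.k a.toZdIdx.η (a.toZdIdx.Ω 0) (a.toZdIdx.Λs a.toZdIdx.k) U₀ f →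
      (∀ x, IsSelfAdjoint (f x)) → (∀ x, x ∉ a.toZdIdx.Ω 0 → f x = 0) →
      Bdd θ.L a.toZdIdx.k a.toZdIdx.η (-(2 : ℝ)) (fun j (x : Site θ.D) => x ∈ a.toZdIdx.Ω j) f →
      msup θ.L a.toZdIdx.k a.toZdIdx.η (-(2 : ℝ)) (fun j (x : Site θ.D) => x ∈ a.toZdIdx.Ω j) f < γ₈ * (α₀ + α₁) →
      msup θ.L a.toZdIdx.k a.toZdIdx.η (-(3 : ℝ)) (fun j (p : Fin θ.D × Site θ.D) => p.2 ∈ a.toZdIdx.Ω j) (fun p => covDerivFwd a.toZdIdx.η U₀ p.1 f p.2) < γ₈ * (α₀ + α₁) →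
      InAk θ.L a.toZdIdx.k a.toZdIdx.η α₀ a.toZdIdx.Ω U₀ → InAk θ.L a.toZdIdx.k a.toZdIdx.η α₀ a.toZdIdx.Ω (mulCfg W U₀) → IsLandau146W θ.L a.toZdIdx.k a.toZdIdx.η (a.toZdIdx.Ω 0) (a.toZdIdx.Λs a.toZdIdx.k) U₀ f W →
      ∀ A' : Site θ.D → Fin θ.D → θ.𝔸, (∀ y τ, IsSelfAdjoint (A' y τ)) → IsPeriodic P A' →
      (∀ j, j ≤ a.toZdIdx.k → ∀ (y : Site θ.D) (τ : Fin θ.D), SideTouches (a.toZdIdx.Ω j) y τ →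
        W y τ = cfgExp a.toZdIdx.η A' y τ ∧ ‖A' y τ‖ ≤ α₂ * ((θ.L : ℝ) ^ j * a.toZdIdx.η)⁻¹) →
      (∀ (y : Site θ.D) (τ : Fin θ.D), (∀ j, j ≤ a.toZdIdx.k → ¬ SideTouches (a.toZdIdx.Ω j) y τ) → A' y τ = 0) →
      msup θ.L a.toZdIdx.k a.toZdIdx.η (-(1 : ℝ)) (fun j (b : Site θ.D × Fin θ.D) => SideTouches (a.toZdIdx.Ω j) b.1 b.2) (fun b => A' b.1 b.2)
          ≤ B₀ * (bondNorm θ.L a.toZdIdx.k a.toZdIdx.η (-(3 : ℝ)) a.toZdIdx.Ω (fun x μ => Jcur a.toZdIdx.η U₀ A' μ x)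
            + wsup 1 (fun p : {p : ℕ × (Site θ.D × Fin θ.D) // p.1 ≤ a.toZdIdx.k ∧ p.2 ∈ towerBondsP θ.L a.toZdIdx.Ω (a.toZdIdx.Λs a.toZdIdx.k) p.1} =>
                linCovIter θ.L U₀ (iEta a.toZdIdx.η A') p.1.1 p.1.2.1 p.1.2.2)) + γ'' * B₀ * (α₀ + α₁) ∧
        msup θ.L a.toZdIdx.k a.toZdIdx.η (-(2 : ℝ)) (fun j (t : Fin θ.D × Fin θ.D × Site θ.D) => SideTouches (a.toZdIdx.Ω j) t.2.2 t.2.1)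
            (fun t => covDerivFwd a.toZdIdx.η U₀ t.1 (fun z => A' z t.2.1) t.2.2)
          ≤ B₀ * (bondNorm θ.L a.toZdIdx.k a.toZdIdx.η (-(3 : ℝ)) a.toZdIdx.Ω (fun x μ => Jcur a.toZdIdx.η U₀ A' μ x)
            + wsup 1 (fun p : {p : ℕ × (Site θ.D × Fin θ.D) // p.1 ≤ a.toZdIdx.k ∧ p.2 ∈ towerBondsP θ.L a.toZdIdx.Ω (a.toZdIdx.Λs a.toZdIdx.k) p.1} =>
                linCovIter θ.L U₀ (iEta a.toZdIdx.η A') p.1.1 p.1.2.1 p.1.2.2)) + γ'' * B₀ * (α₀ + α₁) ∧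
        bondNorm θ.L a.toZdIdx.k a.toZdIdx.η (-(3 : ℝ)) a.toZdIdx.Ω (fun x μ => pdiv a.toZdIdx.η U₀ (plaqCovDeriv a.toZdIdx.η U₀ A') μ x)
          ≤ B₀ * (bondNorm θ.L a.toZdIdx.k a.toZdIdx.η (-(3 : ℝ)) a.toZdIdx.Ω (fun x μ => Jcur a.toZdIdx.η U₀ A' μ x)
            + wsup 1 (fun p : {p : ℕ × (Site θ.D × Fin θ.D) // p.1 ≤ a.toZdIdx.k ∧ p.2 ∈ towerBondsP θ.L a.toZdIdx.Ω (a.toZdIdx.Λs a.toZdIdx.k) p.1} =>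
                linCovIter θ.L U₀ (iEta a.toZdIdx.η A') p.1.1 p.1.2.1 p.1.2.2)) + γ'' * B₀ * (α₀ + α₁) ∧
        bondNorm θ.L a.toZdIdx.k a.toZdIdx.η (-(3 : ℝ)) a.toZdIdx.Ω (fun x μ => covLap a.toZdIdx.η U₀ (fun z => A' z μ) x)
          ≤ B₀ * (bondNorm θ.L a.toZdIdx.k a.toZdIdx.η (-(3 : ℝ)) a.toZdIdx.Ω (fun x μ => Jcur a.toZdIdx.η U₀ A' μ x)
            + wsup 1 (fun p : {p : ℕ × (Site θ.D × Fin θ.D) // p.1 ≤ a.toZdIdx.k ∧ p.2 ∈ towerBondsP θ.L a.toZdIdx.Ω (a.toZdIdx.Λs a.toZdIdx.k) p.1} =>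
                linCovIter θ.L U₀ (iEta a.toZdIdx.η A') p.1.1 p.1.2.1 p.1.2.2)) + γ'' * B₀ * (α₀ + α₁) ∧
        msup θ.L a.toZdIdx.k a.toZdIdx.η (-(2 + β)) (fun j (q : Fin θ.D × Fin θ.D × (Site θ.D × Site θ.D)) => q.2.2 ∈ AdmPair a.toZdIdx.η len ∧ q.2.2.1 ∈ a.toZdIdx.Ω j ∧ q.2.2.2 ∈ a.toZdIdx.Ω j)
            (fun q => hquot a.toZdIdx.η β len U₀ (covDerivFwd a.toZdIdx.η U₀ q.1 (fun z => A' z q.2.1)) q.2.2)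
          ≤ B₀β * (bondNorm θ.L a.toZdIdx.k a.toZdIdx.η (-(3 : ℝ)) a.toZdIdx.Ω (fun x μ => Jcur a.toZdIdx.η U₀ A' μ x)
            + wsup 1 (fun p : {p : ℕ × (Site θ.D × Fin θ.D) // p.1 ≤ a.toZdIdx.k ∧ p.2 ∈ towerBondsP θ.L a.toZdIdx.Ω (a.toZdIdx.Λs a.toZdIdx.k) p.1} =>
                linCovIter θ.L U₀ (iEta a.toZdIdx.η A') p.1.1 p.1.2.1 p.1.2.2)) + γβ * (α₀ + α₁))
    -- PROPOSITION 3 AS PRINTED at the κ-periodic family (server: the guarded Prop-3 socket road) — HYPOTHESIS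
    (hP3 : B8.Prop3Printed θ.D (θ.L : ℝ) (2097152 * ((θ.D : ℝ) + 1) ^ 2 * (θ.L : ℝ) ^ 2) ⟨B₀, B₀', hB₀, hB₀'⟩ B₀β
      (fun j : IdxB8SubDPerκ θ P Mκ Rκ => (famB8OfRecordSubBP₂DPer θ β len P j.1).toGFData2))
    -- PROPOSITION 5 (1.108) ∕ (1.109) AT THE PERIODIC MEMBERS OF RECORD (`zdLanPer`; IR-N05-P5NS currency 2) — HYPOTHESES
    (p5ePer : B8.Prop5Exists B₀' (5 * (θ.D : ℝ) * θ.L * B₈ * (1 + 11 * (θ.D : ℝ) ^ 2))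
      (lanOfRecordSubCκPer θ P Mκ Rκ (5 * (θ.D : ℝ) * θ.L * B₈ * (1 + 11 * (θ.D : ℝ) ^ 2))))
    (p5uPer : B8.Prop5Unique (lanOfRecordSubCκPer θ P Mκ Rκ (5 * (θ.D : ℝ) * θ.L * B₈ * (1 + 11 * (θ.D : ℝ) ^ 2)))) :
    ∃ (lam : ResidB8 θ) (c₁ : ℝ) (ρ₀' : ℕ)
      (ax : ∀ j : IdxB8SubDPer θ P, (famB8OfRecordPer θ (lam.cutSubBP₅κPer P Mκ Rκ c₁ ρ₀').β (lam.cutSubBP₅κPer P Mκ Rκ c₁ ρ₀').len P j).Cfg →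
        (famB8OfRecordPer θ (lam.cutSubBP₅κPer P Mκ Rκ c₁ ρ₀').β (lam.cutSubBP₅κPer P Mκ Rκ c₁ ρ₀').len P j).Pert →
        (famB8OfRecordPer θ (lam.cutSubBP₅κPer P Mκ Rκ c₁ ρ₀').β (lam.cutSubBP₅κPer P Mκ Rκ c₁ ρ₀').len P j).Pert),
      0 < c₁ ∧ 1 ≤ ρ₀' ∧ B8LeafOfRecordSubBP₂DPerκ θ P Mκ Rκ ⟨lam.cutSubBP₅κPer P Mκ Rκ c₁ ρ₀', ax⟩ := by
  -- constants
  have hB₈ : 0 < B₈ := lt_of_lt_of_le hB₀ hB₀8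
  have h5 : 0 ≤ 5 * (θ.D : ℝ) * θ.L := by positivity
  have hB8' : 2 ≤ 5 * (θ.D : ℝ) * θ.L * B₈ := hB.trans (mul_le_mul_of_nonneg_left hB₀8 h5)
  have hγ₈pos : 0 < γ₈ := lt_of_lt_of_le one_pos hγ₈
  -- THE LAYER, as a literal (constants outer)
  let lam : ResidB8 θ :=
    { β := β, len := len, I8c := PEmpty, lan := fun i => i.elim, I8d := PEmpty, cub := fun i => i.elim, toAxial := fun _ _ U => U,
      inp := ⟨B₀, B₀', hB₀, hB₀'⟩,
      C₂ := 2097152 * ((θ.D : ℝ) + 1) ^ 2 * (θ.L : ℝ) ^ 2, B₁' := 5 * (θ.D : ℝ) * θ.L * B₈,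
      B₁ := 5 * (θ.D : ℝ) * θ.L * B₈ * (1 + 11 * (θ.D : ℝ) ^ 2), B₂ := 5 * (θ.D : ℝ) * θ.L * B₈β * (1 + 11 * (θ.D : ℝ) ^ 2), c₁ := 0, B₀β := B₀β }
  -- the periodic members' domain law restricted to `j ≤ k` (the index's face)
  have hΩp : ∀ a : IdxB8SubDPerκ θ P Mκ Rκ, ∀ l, l ≤ a.toZdIdx.k → IsPeriodic P (fun x : Site θ.D => x ∈ a.toZdIdx.Ω l) :=
    fun a l _ => a.periodic l
  -- PROPOSITION 3 WITH SOURCE at the print-class periodic members from the GUARDED sourced b9 socket (T6e)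
  obtain ⟨cP3', hcP3', SP3src⟩ := sp3src_zdGF3HP₂Per_map_of_sockB9P3srcH2Per_γ (𝔸 := θ.𝔸) (γ := γ₈) hD θ.two_le_L hB₀ hB₀β.le hcP3 hγ'' hγB'' hB8β β len
    (fun j : IdxB8SubDPerκ θ P Mκ Rκ => j.toZdIdx) (fun _ => P) hΩp SB9srcH2Per
  -- THEOREM 8 (surviving) at the print-class periodic members FROM THE GUARDED SOCKETS (T6c), then `γ₈ ↦ 1`
  have t8γ := thm8SurvivingAt_zdGF3HP₂Per_map_lanE_γ'_guarded (𝔸 := θ.𝔸) (β := β) (len := len) hD θ.two_le_L hB₀ hB₀' hcu hcP hcP3'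
    hγ₈pos hγ' hB₈ hB₀8 hB8' hγB (fun j : IdxB8SubDPerκ θ P Mκ Rκ => j.toZdIdx) (fun _ => P) (fun j => j.1.1.1.1.1.2) hΩp
    (fun j => IdxB8SubB.tower_all j.1.1.1.1)
    (fun j U₀ f m W => LanF146 θ.L j.toZdIdx.k j.toZdIdx.η (j.toZdIdx.Ω 0) j.toZdIdx.Λs U₀ f m W)
    (fun j U₀ f W => lanF146_top_iff θ.L j.toZdIdx.k j.toZdIdx.η (j.toZdIdx.Ω 0) j.toZdIdx.Λs U₀ f W)
    SP5base SP5 SH59src SP5u SP3src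
  have t8 : B8Thm8Surviving.Thm8SurvivingAt 1 lam.B₁ lam.B₂ (fun j : IdxB8SubDPerκ θ P Mκ Rκ => famB8OfRecordSubBP₂DPer θ lam.β lam.len P j.1) :=
    B8Thm8Surviving.thm8SurvivingAt_anti _ hγ₈ t8γ
  -- THE ZERO SOURCE is admitted everywhere and is periodic; its gauge condition at level `k` is the carrier's (1.38)
  have hAdm₀ : ∀ a : IdxB8SubDPerκ θ P Mκ Rκ, ∀ α₀ α₁ : ℝ, 0 < α₀ → 0 < α₁ → ∀ U₀ : Site θ.D → Fin θ.D → θ.𝔸ˣ, (∀ x κ, U₀ x κ ∈ unitaryUnits θ.𝔸) →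
      (((InR138 θ.L a.toZdIdx.k a.toZdIdx.η (a.toZdIdx.Ω 0) (a.toZdIdx.Λs a.toZdIdx.k) U₀ 0 ∧ (∀ x, IsSelfAdjoint ((0 : Site θ.D → θ.𝔸) x)) ∧
          (∀ x, x ∉ a.toZdIdx.Ω 0 → (0 : Site θ.D → θ.𝔸) x = 0) ∧
          Bdd θ.L a.toZdIdx.k a.toZdIdx.η (-(2 : ℝ)) (fun j (x : Site θ.D) => x ∈ a.toZdIdx.Ω j) 0) ∧ IsPeriodic P (0 : Site θ.D → θ.𝔸)) ∧
        msup θ.L a.toZdIdx.k a.toZdIdx.η (-(2 : ℝ)) (fun j (x : Site θ.D) => x ∈ a.toZdIdx.Ω j) 0 < γ₈ * (α₀ + α₁)) :=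
    fun a α₀ α₁ hα₀ hα₁ U₀ _ => by
      have hBdd0 : Bdd θ.L a.toZdIdx.k a.toZdIdx.η (-(2 : ℝ)) (fun j (x : Site θ.D) => x ∈ a.toZdIdx.Ω j) (0 : Site θ.D → θ.𝔸) :=
        bdd_of_forall (c := 0) fun _ _ _ _ => by simp
      have hmsup0 : msup θ.L a.toZdIdx.k a.toZdIdx.η (-(2 : ℝ)) (fun j (x : Site θ.D) => x ∈ a.toZdIdx.Ω j) (0 : Site θ.D → θ.𝔸) ≤ 0 :=
        msup_le le_rfl fun _ _ _ _ => by simp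
      exact ⟨⟨⟨inR138_zero a.toZdIdx.η θ.L U₀ a.toZdIdx.k (a.toZdIdx.Ω 0) (a.toZdIdx.Λs a.toZdIdx.k), fun _ => IsSelfAdjoint.zero θ.𝔸, fun _ _ => rfl,
          hBdd0⟩, fun _ _ => rfl⟩, lt_of_le_of_lt hmsup0 (mul_pos hγ₈pos (add_pos hα₀ hα₁))⟩
  -- THE SLOT AT THE PERIODIC κ-PIN, conjunct by conjunct (the pin's `Iff.rfl` face)
  refine ⟨lam, c₁s, ρ₀, fun _ U₀ _ => (U₀, ⟨1, fun _ _ => (unitaryUnits θ.𝔸).one_mem, fun _ _ => rfl⟩), hc₁s, hρ₀,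
    (b8LeafOfRecordSubBP₂DPerκ_cutSubBP₅κPer_iff lam c₁s ρ₀ _).2 ?_⟩
  exact
  { l1 := lemma1Printed_blockPairNA θ.D θ.L θ.𝔸
    t2 := thm2Printed_zdGF3HP₂Per_mapJ_γ' (𝔸 := θ.𝔸) (β := β) (len := len) hD θ.two_le_L lam.inp hB₀β hcu hcP le_rfl hγ' hB₈ hB₀8 hB8' hγB
      (fun j : IdxB8SubDPerκ θ P Mκ Rκ => j.toZdIdx) (fun _ => P)
      (fun a f U₀ a0 b0 => ((InR138 θ.L a.toZdIdx.k a.toZdIdx.η (a.toZdIdx.Ω 0) (a.toZdIdx.Λs a.toZdIdx.k) U₀ f ∧ (∀ x, IsSelfAdjoint (f x)) ∧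
          (∀ x, x ∉ a.toZdIdx.Ω 0 → f x = 0) ∧ Bdd θ.L a.toZdIdx.k a.toZdIdx.η (-(2 : ℝ)) (fun j (x : Site θ.D) => x ∈ a.toZdIdx.Ω j) f) ∧ IsPeriodic P f) ∧
        msup θ.L a.toZdIdx.k a.toZdIdx.η (-(2 : ℝ)) (fun j (x : Site θ.D) => x ∈ a.toZdIdx.Ω j) f < γ₈ * (a0 + b0))
      (fun a U₀ f m W => LanF146 θ.L a.toZdIdx.k a.toZdIdx.η (a.toZdIdx.Ω 0) a.toZdIdx.Λs U₀ f m W)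
      SP5base SP5 SH59src SP5u 0 hAdm₀
      (fun a U₀ W => lanF146_zero_iff θ.L a.toZdIdx.k a.toZdIdx.η (a.toZdIdx.Ω 0) a.toZdIdx.Λs U₀ a.toZdIdx.k W)
      (fun j => j.1.1.1.1.1.2) (fun j l _ => j.periodic l) (fun j => IdxB8SubB.tower_all j.1.1.1.1) hP3
    p3 := hP3
    t4 := thm4Printed_zdGF3HP₂Per_mapJ_γ' (𝔸 := θ.𝔸) (β := β) (len := len) hD θ.two_le_L hB₀ hB₀' hcu hcP hγ' hB₈ hB₀8 hB8' hγB
      (fun j : IdxB8SubDPerκ θ P Mκ Rκ => j.toZdIdx) (fun _ => P)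
      (fun a f U₀ a0 b0 => ((InR138 θ.L a.toZdIdx.k a.toZdIdx.η (a.toZdIdx.Ω 0) (a.toZdIdx.Λs a.toZdIdx.k) U₀ f ∧ (∀ x, IsSelfAdjoint (f x)) ∧
          (∀ x, x ∉ a.toZdIdx.Ω 0 → f x = 0) ∧ Bdd θ.L a.toZdIdx.k a.toZdIdx.η (-(2 : ℝ)) (fun j (x : Site θ.D) => x ∈ a.toZdIdx.Ω j) f) ∧ IsPeriodic P f) ∧
        msup θ.L a.toZdIdx.k a.toZdIdx.η (-(2 : ℝ)) (fun j (x : Site θ.D) => x ∈ a.toZdIdx.Ω j) f < γ₈ * (a0 + b0))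
      (fun a U₀ f m W => LanF146 θ.L a.toZdIdx.k a.toZdIdx.η (a.toZdIdx.Ω 0) a.toZdIdx.Λs U₀ f m W)
      SP5base SP5 SH59src SP5u 0 hAdm₀
      (fun a U₀ W => lanF146_zero_iff θ.L a.toZdIdx.k a.toZdIdx.η (a.toZdIdx.Ω 0) a.toZdIdx.Λs U₀ a.toZdIdx.k W)
      (fun j => IdxB8SubB.tower_all j.1.1.1.1) (fun j l _ => j.periodic l)
    p5e := p5ePer
    p5u := p5uPer
    p6 := hP6 (fun jB : IdxB8SubB θ => jB.1.1) lam.B₁ c₁s hB₁big le_rfl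
    p7 := B8LeafKnit.prop7PrintedR_precomp (fun j : IdxB8SubDPerκ θ P Mκ Rκ => j.1) _ _ (prop7PrintedR_famB8OfRecordSubBP₂DPer_unitAxial θ _ _ P)
    t8 := t8 }

variable {θ} in
/-- **THE κ-INDEX INHABITATION CERTIFICATE AT THE Slot8κ′ PERIOD** (ref-A READ-42 WATCH-K2-PIN-INHABITATION; plan 10PRIME rider): for `1 ≤ Mκ` and `θ.L ≤ Rκ·Mκ` the
print-class periodic index at `P := Mκ·θ.L` is inhabited (dag-n05-w1's `nonempty_idxB8SubDPerκ`), so the ∃-body above is not met by an empty [B8] family when the door brings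
these two guards (and Proposition 5's index is inhabited too: `nonempty_idxB8LanCκPer`). [cite: Balaban1985RegularSpaces, (1.3)–(1.4) p.77, p.77 («Ω_j ⊂ T_η») (bookkeeping)] -/
theorem nonempty_idxB8SubDPerκ_slot8κ' {Mκ Rκ : ℕ} (hMκ : 1 ≤ Mκ) (hRκ : θ.L ≤ Rκ * Mκ) :
    Nonempty (IdxB8SubDPerκ θ (Mκ * θ.L) Mκ Rκ) ∧ Nonempty (IdxB8LanCκPer θ (Mκ * θ.L) Mκ Rκ) := by
  have hL1 : 1 ≤ θ.L := le_trans one_le_two θ.two_le_L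
  have hP : 0 < Mκ * θ.L := Nat.mul_pos (Nat.lt_of_lt_of_le Nat.zero_lt_one hMκ) (Nat.lt_of_lt_of_le Nat.zero_lt_one hL1)
  exact ⟨nonempty_idxB8SubDPerκ (θ := θ) hMκ hRκ hP dvd_rfl, nonempty_idxB8LanCκPer hMκ hRκ hP dvd_rfl⟩

end GuardedSockets

end Summit.QuantumFields.YangMills.BalabanUVNodes.N05SubBP2DK2PerKappaSlotExistsOfGuardedSockets

end
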